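import Summits.CriticalPhenomena.PercolationContinuityZ3.Theorems.PercNearOneGluingNoHeavyLowerTailSahiTangentLayerProduct
import Summits.CriticalPhenomena.PercolationContinuityZ3.Theorems.PercNearOneGluingNoHeavyLowerTailSahiTangentPairCriterion
import Summits.CriticalPhenomena.PercolationContinuityZ3.Theorems.PercNearOneGluingNoHeavyLowerTailSahiTangentScalingVertex
import HarnessLib

/-!
# `NoHeavyLowerTail` (crux stmt-CriticalPhenomena-4575), Sahi programme: **SAHI POSITIVITY IS INHERITED BY COIN-CUMULATIONS —
# adjoining an independent coin `ε ~ Bern(s)`: if a class `𝓕` of functions on `α` is Sahi-nonnegative under `μ` at every order `≤ n`,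
# then every family `F_l(ε,x) = g_l(x) + ε·h_l(x)` with `g_l, h_l ∈ 𝓕` has `E_n^{B_s⊗μ}(F) ≥ 0`** (all orders; the `E_n`-level
# mechanism of Sahi's Theorem 1/2, extended from constants to any Sahi-positive class)

Support file (Sahi cell, seat `prim-sahi-p1`, generation 52; `--supports stmt-CriticalPhenomena-4575`).  Pure proofs, NO definitions,
no `sorry`, standard axioms.  Uses `sahiE_add_eq_sum_subsets` (`…SahiTangentLayerProduct`, gen 52) and the all-orders VERTEX theorem
`mul_sahiE_le_sahiE_coin_vertex` (`…SahiTangentPairCriterion`, gen 51).  Coin product `B_s ⊗ μ` on `Bool × α` =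
`fun z => if z.1 then s * μ z.2 else (1 - s) * μ z.2` as in all `…SahiTangent*` files.

THE MATHEMATICS.
* `sahiE_coin_cumul_eq_sum`: by multilinearity, `E_n^{B_s⊗μ}(g + ε·h) = Σ_{L ⊆ [n]} E_n^{B_s⊗μ}(F^L)`, where `F^L` is the VERTEX family
  with slots `ε·h_l` (`l ∈ L`, top-only) and `g_l` (`l ∉ L`, plain).
* `sahiE_coin_cumul_nonneg` (**class closure**): if `0 ≤ E_m^{μ}(φ)` for every `m ≤ n` and every `m`-family `φ` drawn from a class `𝓕`,
  then `0 ≤ E_n^{B_s⊗μ}(g + ε·h)` for all `g_l, h_l ∈ 𝓕` and `0 ≤ s ≤ 1` — each vertex term is `≥ s·E_n^{μ}(f^L) ≥ 0`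
  (`f^L_l = h_l` on `L`, `g_l` off `L`, a family from `𝓕`) by the vertex theorem, and the plain term is `E_n^{μ}(g) ≥ 0`.
  READING.  With `𝓕` = nonnegative constants on a point this is the induction step of Sahi's Theorem 1/2 [Sahi2008, Thm. 1–2: the
  cumulations `𝒞[X]` are Sahi-positive under product measures at every order] done at the `E_n` level (the tree proves Theorem 2 by
  the generating function, `Literature…sahi2008_thm2`); the point here is that the base may be ANY Sahi-positive class, so the new
  coordinate need only enter CUMULATIVELY (`F(1,·) − F(0,·) ∈ 𝓕`) while the old coordinates enter through arbitrary members of `𝓕`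
  — e.g. arbitrary nonnegative monotone functions on an FKG lattice settled at every order.  Iterating over `k` independent coins gives
  Sahi positivity, at every order, of all `F(ε,x) = Σ_{S⊆[k]} (Π_{i∈S} ε_i)·h_S(x)`, `h_S ∈ 𝓕` ("coin-cumulations with coefficients in
  `𝓕`") under `Bern(s_1) ⊗ ⋯ ⊗ Bern(s_k) ⊗ μ` (apply the theorem `k` times, each time to the class just obtained).
* Instances: `…_of_sahiPositive` (`𝓕` = nonnegative monotone functions, hypothesis `SahiPositive μ n`), and UNCONDITIONALLY at every
  order for every FKG weight on a finite distributive lattice with `≤ 3` join-irreducibles (`…_of_card_supIrred_le_three`, via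
  `SahiCubeAllOrders.sahiPositive_of_card_supIrred_le_three`) and on every two-dimensional grid (`…_of_prod`, via
  `SahiTwoDim.sahiPositive_of_isFKGMeasure_prod`).  For indicator data (`g_l = 1_{U_l}`, `h_l = 1_{V_l}`, `U_l, V_l` ARBITRARY up-sets,
  not nested) the functions `1_{U_l} + ε·1_{V_l}` are monotone on `Bool × α` but are NOT indicators of up-sets unless `V_l ⊆ U_l`-trivial
  cases — the class is "cumulative in the coin, monotone in `α`", strictly between Sahi's `𝒞` and all monotone functions.
Nothing conjectural is asserted. [this work; cf. Sahi2008, Thm. 1–2 (pp. 210–211, 218–219)]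
-/

namespace Summit.CriticalPhenomena.PercolationContinuityZ3.Theorems.SahiTangent

open Finset Function Literature.Combinatorics.Sahi2008
open scoped BigOperators

noncomputable section

variable {α : Type*} [Fintype α] {n : ℕ}

/-- **Multilinear expansion into vertex families**: `E_n^{B_s⊗μ}(g + ε·h) = Σ_{L ⊆ [n]} E_n^{B_s⊗μ}(F^L)`, `F^L_l = ε·h_l` (`l ∈ L`),
`g_l` (`l ∉ L`). [this work] -/
theorem sahiE_coin_cumul_eq_sum (μ : α → ℝ) (s : ℝ) (g h : Fin n → α → ℝ) :
    sahiE (fun z : Bool × α => if z.1 then s * μ z.2 else (1 - s) * μ z.2) n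
        (fun l (z : Bool × α) => g l z.2 + if z.1 then h l z.2 else 0)
      = ∑ L : Finset (Fin n), sahiE (fun z : Bool × α => if z.1 then s * μ z.2 else (1 - s) * μ z.2) n
          (fun l (z : Bool × α) => if z.1 then (if l ∈ L then h l else g l) z.2
            else if l ∈ L then 0 else (if l ∈ L then h l else g l) z.2) := by
  classical
  have h1 : (fun l (z : Bool × α) => g l z.2 + if z.1 then h l z.2 else 0)
      = fun l => (fun z : Bool × α => g l z.2) + fun z : Bool × α => if z.1 then h l z.2 else 0 := by
    funext l z; simp only [Pi.add_apply]
  rw [h1, sahiE_add_eq_sum_subsets]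
  refine Finset.sum_congr rfl fun L _ => ?_
  congr 1
  funext l z
  by_cases hl : l ∈ L <;> by_cases hz : z.1 = true <;> simp [hl, hz]

/-- **Sahi positivity is inherited by coin-cumulations (class closure under an independent coin).**  Let `μ` be any real weight on
a finite type `α` and `𝓕` a class of functions such that `0 ≤ E_m^{μ}(φ)` for every `m ≤ n` and every family `φ` from `𝓕`.  Then for
`0 ≤ s ≤ 1` and `g_l, h_l ∈ 𝓕`:  `0 ≤ E_n^{B_s⊗μ}(g_0 + ε·h_0, …, g_{n−1} + ε·h_{n−1})`. [this work; cf. Sahi2008, Thm. 1–2] -/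
theorem sahiE_coin_cumul_nonneg (μ : α → ℝ) {s : ℝ} (hs0 : 0 ≤ s) (hs1 : s ≤ 1) (𝓕 : Set (α → ℝ))
    (h𝓕 : ∀ m, m ≤ n → ∀ φ : Fin m → α → ℝ, (∀ i, φ i ∈ 𝓕) → 0 ≤ sahiE μ m φ)
    (g h : Fin n → α → ℝ) (hg : ∀ l, g l ∈ 𝓕) (hh : ∀ l, h l ∈ 𝓕) :
    0 ≤ sahiE (fun z : Bool × α => if z.1 then s * μ z.2 else (1 - s) * μ z.2) n
        (fun l (z : Bool × α) => g l z.2 + if z.1 then h l z.2 else 0) := by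
  classical
  rw [sahiE_coin_cumul_eq_sum]
  refine Finset.sum_nonneg fun L _ => ?_
  -- the mixed family `f^L`
  have hfL : ∀ l, (if l ∈ L then h l else g l) ∈ 𝓕 := fun l => by
    by_cases hl : l ∈ L
    · rw [if_pos hl]; exact hh l
    · rw [if_neg hl]; exact hg l
  rcases Finset.eq_empty_or_nonempty L with hL | hL
  · -- plain family: `E_n^{B_s⊗μ}(g ∘ snd) = E_n^{μ}(g)`
    subst hL
    simp only [Finset.notMem_empty, if_false, ite_self]
    rw [sahiE_coin_snd μ s n g]
    exact h𝓕 n le_rfl g hg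
  · -- a vertex: `E ≥ s·E_n^{μ}(f^L) ≥ 0`
    obtain ⟨m, rfl⟩ : ∃ m, n = m + 1 := Nat.exists_eq_add_one.2 (Finset.card_pos.2 hL |>.trans_le (by
      simpa using Finset.card_le_univ L))
    refine le_trans (mul_nonneg hs0 (h𝓕 (m + 1) le_rfl _ hfL)) ?_
    exact mul_sahiE_le_sahiE_coin_vertex μ hs0 hs1 _ L hL fun k hk e _ => h𝓕 k (Nat.le_succ_of_le hk) _ fun j => hfL (e j)

/-- **Iteration-ready form**: under the hypothesis of `sahiE_coin_cumul_nonneg`, the class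
`𝓕' = {z ↦ g(z.2) + [z.1]·h(z.2) : g, h ∈ 𝓕}` on `Bool × α` satisfies THE SAME hypothesis for the weight `B_s ⊗ μ` (every order `≤ n`);
so the theorem can be applied again to `𝓕'` and a further independent coin, and so on — after `k` steps: all coin-cumulations
`Σ_{S⊆[k]} (Π_{i∈S} ε_i)·h_S`, `h_S ∈ 𝓕`, are Sahi-nonnegative under `Bern(s_1) ⊗ ⋯ ⊗ Bern(s_k) ⊗ μ` at every order `≤ n`.
[this work; cf. Sahi2008, Thm. 1–2] -/
theorem sahiE_coin_cumul_class (μ : α → ℝ) {s : ℝ} (hs0 : 0 ≤ s) (hs1 : s ≤ 1) (𝓕 : Set (α → ℝ))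
    (h𝓕 : ∀ m, m ≤ n → ∀ φ : Fin m → α → ℝ, (∀ i, φ i ∈ 𝓕) → 0 ≤ sahiE μ m φ) :
    ∀ m, m ≤ n → ∀ Φ : Fin m → Bool × α → ℝ,
      (∀ i, Φ i ∈ {ψ : Bool × α → ℝ | ∃ g ∈ 𝓕, ∃ h ∈ 𝓕, ψ = fun z => g z.2 + if z.1 then h z.2 else 0}) →
        0 ≤ sahiE (fun z : Bool × α => if z.1 then s * μ z.2 else (1 - s) * μ z.2) m Φ := by
  intro m hm Φ hΦ
  choose g hg h hh hΦ using hΦ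
  have : Φ = fun l (z : Bool × α) => g l z.2 + if z.1 then h l z.2 else 0 := funext hΦ
  subst this
  exact sahiE_coin_cumul_nonneg μ hs0 hs1 𝓕 (fun m' hm' => h𝓕 m' (hm'.trans hm)) g h hg hh

/-! ### Instances -/

section Positive

variable [Preorder α]

/-- **Nonnegative monotone data, Sahi-positive weight.**  If `μ` is a probability weight with `SahiPositive μ n`, then for nonnegative
monotone `g_l, h_l` and `0 ≤ s ≤ 1`:  `0 ≤ E_n^{B_s⊗μ}(g + ε·h)` — the new coordinate enters cumulatively, the old ones through
arbitrary monotone functions. [this work; cf. Sahi2008, Thm. 2] -/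
theorem sahiE_coin_cumul_nonneg_of_sahiPositive {μ : α → ℝ} (hμ₀ : ∀ x, 0 ≤ μ x) (hμ₁ : ∑ x, μ x = 1)
    (hP : SahiPositive μ n) {s : ℝ} (hs0 : 0 ≤ s) (hs1 : s ≤ 1) (g h : Fin n → α → ℝ)
    (hg₀ : ∀ l x, 0 ≤ g l x) (hg : ∀ l, Monotone (g l)) (hh₀ : ∀ l x, 0 ≤ h l x) (hh : ∀ l, Monotone (h l)) :
    0 ≤ sahiE (fun z : Bool × α => if z.1 then s * μ z.2 else (1 - s) * μ z.2) n
        (fun l (z : Bool × α) => g l z.2 + if z.1 then h l z.2 else 0) :=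
  sahiE_coin_cumul_nonneg μ hs0 hs1 {φ | (∀ x, 0 ≤ φ x) ∧ Monotone φ}
    (fun _ hm φ hφ => hP.anti hμ₀ hμ₁ hm φ (fun i => (hφ i).1) fun i => (hφ i).2)
    g h (fun l => ⟨hg₀ l, hg l⟩) fun l => ⟨hh₀ l, hh l⟩

end Positive

section FKG

variable [DistribLattice α] [DecidableEq α]

/-- **Unconditional, EVERY order, every FKG weight on a finite distributive lattice with at most three join-irreducibles**
(`SahiCubeAllOrders.sahiPositive_of_card_supIrred_le_three`): `0 ≤ E_n^{B_s⊗ν}(g + ε·h)` for nonnegative monotone `g_l, h_l`.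
[this work] -/
theorem sahiE_coin_cumul_nonneg_of_card_supIrred_le_three (h3 : Nat.card {j : α // SupIrred j} ≤ 3) {ν : α → ℝ}
    (hν : IsFKGMeasure ν) {s : ℝ} (hs0 : 0 ≤ s) (hs1 : s ≤ 1) (g h : Fin n → α → ℝ)
    (hg₀ : ∀ l x, 0 ≤ g l x) (hg : ∀ l, Monotone (g l)) (hh₀ : ∀ l x, 0 ≤ h l x) (hh : ∀ l, Monotone (h l)) :
    0 ≤ sahiE (fun z : Bool × α => if z.1 then s * ν z.2 else (1 - s) * ν z.2) n
        (fun l (z : Bool × α) => g l z.2 + if z.1 then h l z.2 else 0) :=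
  sahiE_coin_cumul_nonneg_of_sahiPositive hν.nonneg hν.sum_eq_one
    (SahiCubeAllOrders.sahiPositive_of_card_supIrred_le_three h3 hν n) hs0 hs1 g h hg₀ hg hh₀ hh

end FKG

/-- **Unconditional, EVERY order, every two-dimensional grid** `β × γ` (two finite linear orders, any FKG weight;
`SahiTwoDim.sahiPositive_of_isFKGMeasure_prod`): `0 ≤ E_n^{B_s⊗ν}(g + ε·h)` for nonnegative monotone `g_l, h_l`. [this work] -/
theorem sahiE_coin_cumul_nonneg_of_prod {β γ : Type*} [LinearOrder β] [Fintype β] [LinearOrder γ] [Fintype γ] {ν : β × γ → ℝ}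
    (hν : IsFKGMeasure ν) {s : ℝ} (hs0 : 0 ≤ s) (hs1 : s ≤ 1) (g h : Fin n → β × γ → ℝ)
    (hg₀ : ∀ l x, 0 ≤ g l x) (hg : ∀ l, Monotone (g l)) (hh₀ : ∀ l x, 0 ≤ h l x) (hh : ∀ l, Monotone (h l)) :
    0 ≤ sahiE (fun z : Bool × (β × γ) => if z.1 then s * ν z.2 else (1 - s) * ν z.2) n
        (fun l (z : Bool × (β × γ)) => g l z.2 + if z.1 then h l z.2 else 0) :=
  sahiE_coin_cumul_nonneg_of_sahiPositive hν.nonneg hν.sum_eq_one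
    (SahiTwoDim.sahiPositive_of_isFKGMeasure_prod hν n) hs0 hs1 g h hg₀ hg hh₀ hh

end

end Summit.CriticalPhenomena.PercolationContinuityZ3.Theorems.SahiTangent
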